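import Literature.Barriers.NavierStokesRegularity.NavierStokesInequalitySourceIdentity
import Literature.Barriers.NavierStokesRegularity.NavierStokesInequalityInteractionDecay
import Literature.Barriers.NavierStokesRegularity.NavierStokesInequalitySwirlTimeDependent
import Literature.Analysis.FluidPDE.NormalisedPressurePerturbation
import HarnessLib

/-!
# Continuity of `∇p[v,f]` with respect to `f` (Ożański 2017, Appendix A.3, first lemma)

Barrier catalogue support file for `NavierStokesRegularity` (D-0021), on the discharge path of
fact D-II `Literature.Barriers.NavierStokesRegularity.NSIProfiles_of_arrangement`
(`NavierStokesInequalityProfiles`; W. S. Ożański, arXiv:1709.00602v4, §4.1–4.2): the slack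
inequality (4.27) of §4.2, Case 2,
`|vᵢ|(|∇(qᵏᵢ,ₜ)² - ∇hᵢ,ₜ²| + 2Σⱼ|∇p[aⱼᵏ(t)vⱼ, qᵏⱼ,ₜ] - ∇p[aⱼᵏ(t)vⱼ, hⱼ,ₜ]|) ≤ δ/2` for `k` large,
is obtained from the uniform convergence `qᵏ → h` with derivatives ((4.23)) through the first
lemma of Appendix A.3 (held plain-text rendering: §8.3, **Lemma 23**; Scheffer 1985, the
uniform-continuity step (3.42)–(3.55) of Lemma 3.2):

> Suppose that `v_k ∈ C^∞(P;ℝ²)`, `f_k, f ∈ C^∞(P;[0,∞))` are such that `|v_k| < min(f_k,f)`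
> and `supp v_k, supp f_k, supp f ⊆ K` for all `k`, where `K` is a compact subset of `P`, and
> that `f_k → f` and `∇f_k → ∇f` uniformly in `P`. Then `∇p[v_k,f_k] - ∇p[v_k,f] → 0`
> uniformly on `ℝ²`. The point of the lemma is that we do not require any convergence of the
> `v_k`'s.

This file PROVES it, in quantitative form, for the tree's objects (pairs of structures
`(v,f,φ)`, `(v,g,ψ)` on the same `U ⋐ P` — exactly the situation of (4.27), where
`(aⱼᵏ(t)vⱼ, qᵏⱼ,ₜ, φⱼ)` and `(aⱼᵏ(t)vⱼ, hⱼ,ₜ, φⱼ)` share the planar field):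

* `IsNSIStructure.norm_fderiv_normalisedPressure_swirlField_sub_le` — with `σ = f² - g²`,
  `‖Dσ‖ ≤ S₁`, `‖D²σ‖ ≤ S₂` on the plane, `r₀` the axis margin of `U` and `R(Ū) ⊆ B̄(0,R)`:
  **`‖∇p*[v,f](x) - ∇p*[v,g](x)‖ ≤ (1 + (4π)⁻¹|B̄(0,R)|)(S₂/r₀ + S₁/r₀²)`** for all `x ∈ ℝ³`;
* `IsNSIStructure.abs_derivR_planePressure_sub_le`, `….abs_derivZ_planePressure_sub_le` — the
  same bound for `|∂ᵣ p[v,f] - ∂ᵣ p[v,g]|`, `|∂_z p[v,f] - ∂_z p[v,g]|` on the whole plane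
  ("the claim of the lemma follows by setting `x₃ = 0`");
* `exists_planePressure_sub_le` — packaged: for every `U` there is `K ≥ 0` with
  `|∇p[v,f] - ∇p[v,g]| ≤ K(S₁ + S₂)` componentwise for ALL pairs of structures on `U` with a
  common `v` — a modulus independent of `v`, hence uniform along any family `(a(t)v, Q_k(t))`,
  `(a(t)v, Q(t))` as in (4.27);
* `contDiffOn_planePressure_param` — the regularity companion for (4.16): for profiles `Q`
  jointly smooth in `(t,q)` and a smooth direction `a(t) ∈ [-1,1]`,
  `(t,q) ↦ p[a(t)v, Q(t)](q)` is jointly `C^∞` (from the tree's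
  `isSmoothSpaceTimeOn_swirlField_param` and `isSmoothSpaceTimeOn_normalisedPressure`).

The printed hypotheses ask for `C¹` convergence `f_k → f`; the bound here is in terms of two
derivatives of `f_k² - f²` (the derivative having been moved onto the source difference in
`NormalisedPressurePerturbation`), which the application supplies: (4.23) gives convergence of
all derivatives, uniformly on the compact support.

## Proof (as printed, made quantitative)

`G[u[v,f]] - G[u[v,g]] = E ∘ R⁻¹`, `E = -r⁻¹∂ᵣσ` (`NavierStokesInequalitySourceIdentity`,
Ożański's "`F_k - G_k = (∂₂f² - ∂₂f_k²)/2z₂` … all the terms that include the components of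
`v_k`'s vanish"); `E` is smooth, vanishes for `r < r₀`, and `‖DE‖ ≤ S₂/r₀ + S₁/r₀²`
(`norm_fderiv_sourceFactor_le`); lifting costs nothing (`‖h ↦ (⟪ρ̂,h⟫, h₂)‖ ≤ 1`); then
`‖∇p̃[u_f] - ∇p̃[u_g]‖ ≤ (1 + (4π)⁻¹|B̄(0,R)|) sup‖D(G_f - G_g)‖`
(`norm_fderiv_normalisedPressure_sub_le_of_subset`, Ożański's
"`∇p*[v_k,f_k](x) - ∇p*[v_k,f](x) = (4π)⁻¹∫(F_k - G_k)(y)(x-y)/|x-y|³ dy`").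

## Mathlib search

`ContinuousLinearMap.opNorm_comp_le`, `norm_inner_le_norm`, `PiLp.norm_apply_le`,
`fderiv_clm_apply`, `hasFDerivAt_inv`, `ContDiffOn.comp`, `ContDiffOn.congr` (used).

## References

* W. S. Ożański, *On weak solutions to the Navier–Stokes inequality with internal
  singularities*, arXiv:1709.00602v4, Appendix A.3, first lemma (held rendering: §8.3,
  Lemma 23), §4.1 (4.16), §4.2 (4.27), §3.3 (3.21). [`Ozanski2017NSISingular`]
* V. Scheffer, *A solution to the Navier–Stokes inequality with an internal singularity*,
  Comm. Math. Phys. 101 (1985), Lemma 3.2, (3.42)–(3.55). [`Scheffer1985`]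
-/

noncomputable section

open MeasureTheory Set Function Filter Topology TopologicalSpace WithLp Metric Real
open scoped ENNReal InnerProductSpace RealInnerProductSpace ContDiff

namespace Literature.Barriers.NavierStokesRegularity

open Literature.Analysis.FluidPDE

-- nested operator types `ℝ² →L[ℝ] ℝ² →L[ℝ] ℝ` (second derivatives)
set_option maxSynthPendingDepth 3

variable {U : Set (ℝ × ℝ)} {v : ℝ × ℝ → ℝ × ℝ} {f g φ ψ : ℝ × ℝ → ℝ}

/-! ### Planar calculus: norms of `∂ᵣ`, of `D(∂ᵣσ)` and of `D(r⁻¹)` -/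

/-- `|∂ᵣσ(q)| ≤ ‖Dσ(q)‖` (`‖(1,0)‖ = 1` in the sup norm). [folklore] -/
theorem abs_derivR_le (σ : ℝ × ℝ → ℝ) (q : ℝ × ℝ) : |derivR σ q| ≤ ‖fderiv ℝ σ q‖ := by
  rw [derivR, ← Real.norm_eq_abs]
  refine (ContinuousLinearMap.le_opNorm _ _).trans ?_
  rw [Prod.norm_def]; simp

/-- `‖D(∂ᵣσ)(q)‖ ≤ ‖D²σ(q)‖` for `σ ∈ C²`. [folklore] -/
theorem norm_fderiv_derivR_le {σ : ℝ × ℝ → ℝ} (hσ : ContDiff ℝ 2 σ) (q : ℝ × ℝ) :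
    ‖fderiv ℝ (derivR σ) q‖ ≤ ‖fderiv ℝ (fderiv ℝ σ) q‖ := by
  have hd : DifferentiableAt ℝ (fderiv ℝ σ) q :=
    ((hσ.fderiv_right (m := 1) le_rfl).differentiable one_ne_zero) q
  have h : derivR σ = fun q' => fderiv ℝ σ q' ((1 : ℝ), (0 : ℝ)) := rfl
  rw [h, fderiv_clm_apply hd (differentiableAt_const _)]
  simp only [fderiv_fun_const, Pi.zero_apply, ContinuousLinearMap.comp_zero, zero_add]
  refine ContinuousLinearMap.opNorm_le_bound _ (norm_nonneg _) fun h' => ?_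
  rw [ContinuousLinearMap.flip_apply]
  calc ‖fderiv ℝ (fderiv ℝ σ) q h' ((1 : ℝ), (0 : ℝ))‖
      ≤ ‖fderiv ℝ (fderiv ℝ σ) q h'‖ * ‖((1 : ℝ), (0 : ℝ))‖ := ContinuousLinearMap.le_opNorm _ _
    _ ≤ ‖fderiv ℝ (fderiv ℝ σ) q‖ * ‖h'‖ * ‖((1 : ℝ), (0 : ℝ))‖ := by
        gcongr; exact ContinuousLinearMap.le_opNorm _ _
    _ = ‖fderiv ℝ (fderiv ℝ σ) q‖ * ‖h'‖ := by rw [Prod.norm_def]; simp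

/-- `‖D(r⁻¹)(q)‖ ≤ r₀⁻²` for `r = q₁ ≥ r₀ > 0`. [folklore] -/
theorem norm_fderiv_inv_fst_le {q : ℝ × ℝ} {r₀ : ℝ} (hr₀ : 0 < r₀) (hq : r₀ ≤ q.1) :
    ‖fderiv ℝ (fun q' : ℝ × ℝ => q'.1⁻¹) q‖ ≤ (r₀ ^ 2)⁻¹ := by
  have hq0 : q.1 ≠ 0 := by intro h; rw [h] at hq; linarith
  have hd : HasFDerivAt (fun q' : ℝ × ℝ => q'.1⁻¹)
      ((ContinuousLinearMap.smulRight (1 : ℝ →L[ℝ] ℝ) (-(q.1 ^ 2)⁻¹)).comp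
        (ContinuousLinearMap.fst ℝ ℝ ℝ)) q :=
    (hasFDerivAt_inv hq0).comp q hasFDerivAt_fst
  rw [hd.fderiv]
  have happ : ∀ h' : ℝ × ℝ, ((ContinuousLinearMap.smulRight (1 : ℝ →L[ℝ] ℝ) (-(q.1 ^ 2)⁻¹)).comp
      (ContinuousLinearMap.fst ℝ ℝ ℝ)) h' = h'.1 * (-(q.1 ^ 2)⁻¹) := fun h' => by
    simp
  refine ContinuousLinearMap.opNorm_le_bound _ (by positivity) fun h' => ?_
  rw [happ, norm_mul, norm_neg, norm_inv, norm_pow, Real.norm_eq_abs, Real.norm_eq_abs]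
  have h1 : |h'.1| ≤ ‖h'‖ := by rw [← Real.norm_eq_abs]; exact norm_fst_le h'
  have h2 : (|q.1| ^ 2)⁻¹ ≤ (r₀ ^ 2)⁻¹ := by
    rw [abs_of_pos (hr₀.trans_le hq)]
    exact inv_anti₀ (by positivity) (pow_le_pow_left₀ hr₀.le hq 2)
  calc |h'.1| * (|q.1| ^ 2)⁻¹ ≤ ‖h'‖ * (r₀ ^ 2)⁻¹ := mul_le_mul h1 h2 (by positivity) (norm_nonneg _)
    _ = (r₀ ^ 2)⁻¹ * ‖h'‖ := mul_comm _ _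

/-! ### The planar factor `E = -r⁻¹∂ᵣσ` of the source difference and its derivative -/

namespace IsNSIStructure

/-- **The source difference as a lifted planar profile**: for structures `(v,f,φ)`, `(v,g,ψ)`
on `U`, `G[u[v,f]] - G[u[v,g]] = E ∘ R⁻¹` with `E(q) = -q₁⁻¹ ∂ᵣ(f² - g²)(q)`.
[cite: Ozanski2017NSISingular, App. A.3, first lemma (held: Lemma 23), proof] -/
theorem pressureSource_swirlField_sub_eq_comp (hf : IsNSIStructure U v f φ)
    (hg : IsNSIStructure U v g ψ) :
    (fun y => pressureSource (swirlField v f) y - pressureSource (swirlField v g) y) =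
      fun y => (fun q : ℝ × ℝ => -(q.1)⁻¹ * derivR (fun q' => f q' ^ 2 - g q' ^ 2) q)
        (meridian y) :=
  funext fun y => hf.pressureSource_swirlField_sub hg y

/-- The planar factor `E(q) = -q₁⁻¹∂ᵣσ(q)`, `σ = f² - g²`, is smooth on the plane (it vanishes
for `q₁ < r₀`, the axis margin of `U`). [folklore] -/
theorem contDiff_sourceFactor (hf : IsNSIStructure U v f φ) (hg : IsNSIStructure U v g ψ)
    {r₀ : ℝ} (hr₀ : 0 < r₀) (hr : ∀ q ∈ closure U, r₀ ≤ q.1) :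
    ContDiff ℝ ∞ fun q : ℝ × ℝ => -(q.1)⁻¹ * derivR (fun q' => f q' ^ 2 - g q' ^ 2) q := by
  have hσ : ContDiff ℝ ∞ fun q' => f q' ^ 2 - g q' ^ 2 := (hf.f_smooth.pow 2).sub (hg.f_smooth.pow 2)
  have hdσ : ContDiff ℝ ∞ (derivR fun q' => f q' ^ 2 - g q' ^ 2) :=
    (hσ.fderiv_right (m := ∞) (by simp)).clm_apply contDiff_const
  have h0 : ∀ q : ℝ × ℝ, q.1 < r₀ → derivR (fun q' => f q' ^ 2 - g q' ^ 2) q = 0 := by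
    intro q hq
    have hopen : IsOpen {q' : ℝ × ℝ | q'.1 < r₀} := isOpen_lt continuous_fst continuous_const
    have hev : (fun q' => f q' ^ 2 - g q' ^ 2) =ᶠ[𝓝 q] fun _ => (0 : ℝ) := by
      filter_upwards [hopen.mem_nhds hq] with q' hq'
      have hq'' : q' ∉ closure U := fun h' => (hr q' h').not_gt hq'
      simp [hf.f_eq_zero hq'', hg.f_eq_zero hq'']
    rw [derivR, hev.fderiv_eq, fderiv_const_apply]
    rfl
  have h := contDiff_mul_inv_fst_of_eq_zero hdσ hr₀ h0
  have heq : (fun q : ℝ × ℝ => -(q.1)⁻¹ * derivR (fun q' => f q' ^ 2 - g q' ^ 2) q) =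
      fun q => -(derivR (fun q' => f q' ^ 2 - g q' ^ 2) q * q.1⁻¹) := by
    funext q; ring
  rw [heq]
  exact h.neg

/-- **Bound on the derivative of the planar factor**: with `σ = f² - g²`, `‖Dσ‖ ≤ S₁`,
`‖D²σ‖ ≤ S₂` on the plane and `r₀` the axis margin of `U`,
`‖DE(q)‖ ≤ S₂/r₀ + S₁/r₀²` for every `q`. [folklore] -/
theorem norm_fderiv_sourceFactor_le (hf : IsNSIStructure U v f φ) (hg : IsNSIStructure U v g ψ)
    {r₀ : ℝ} (hr₀ : 0 < r₀) (hr : ∀ q ∈ closure U, r₀ ≤ q.1) {S₁ S₂ : ℝ}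
    (hS₁ : ∀ q, ‖fderiv ℝ (fun q' => f q' ^ 2 - g q' ^ 2) q‖ ≤ S₁)
    (hS₂ : ∀ q, ‖fderiv ℝ (fderiv ℝ fun q' => f q' ^ 2 - g q' ^ 2) q‖ ≤ S₂) (q : ℝ × ℝ) :
    ‖fderiv ℝ (fun q : ℝ × ℝ => -(q.1)⁻¹ * derivR (fun q' => f q' ^ 2 - g q' ^ 2) q) q‖ ≤
      S₂ / r₀ + S₁ / r₀ ^ 2 := by
  have hS₁0 : 0 ≤ S₁ := (norm_nonneg _).trans (hS₁ 0)
  have hS₂0 : 0 ≤ S₂ := (norm_nonneg _).trans (hS₂ 0)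
  set σ : ℝ × ℝ → ℝ := fun q' => f q' ^ 2 - g q' ^ 2 with hσdef
  have hσ : ContDiff ℝ ∞ σ := (hf.f_smooth.pow 2).sub (hg.f_smooth.pow 2)
  have hdσ : ContDiff ℝ ∞ (derivR σ) := (hσ.fderiv_right (m := ∞) (by simp)).clm_apply contDiff_const
  by_cases hq : q.1 < r₀
  · -- `E` vanishes near `q`
    have hE := hf.contDiff_sourceFactor hg hr₀ hr
    have hopen : IsOpen {q' : ℝ × ℝ | q'.1 < r₀} := isOpen_lt continuous_fst continuous_const
    have hzero : ∀ q' : ℝ × ℝ, q'.1 < r₀ → σ =ᶠ[𝓝 q'] fun _ => (0 : ℝ) := fun q' hq' => by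
      filter_upwards [hopen.mem_nhds hq'] with q'' hq''
      have : q'' ∉ closure U := fun h' => (hr q'' h').not_gt hq''
      simp [hσdef, hf.f_eq_zero this, hg.f_eq_zero this]
    have hev : (fun q' : ℝ × ℝ => -(q'.1)⁻¹ * derivR σ q') =ᶠ[𝓝 q] fun _ => (0 : ℝ) := by
      filter_upwards [hopen.mem_nhds hq] with q' hq'
      rw [derivR, (hzero q' hq').fderiv_eq, fderiv_const_apply]
      simp
    rw [hev.fderiv_eq, fderiv_const_apply]
    simp only [ContinuousLinearMap.opNorm_zero]
    positivity
  · rw [not_lt] at hq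
    have hq0 : q.1 ≠ 0 := by intro h; rw [h] at hq; linarith
    have hι : DifferentiableAt ℝ (fun q' : ℝ × ℝ => q'.1⁻¹) q := differentiableAt_fst.inv hq0
    have hD : DifferentiableAt ℝ (derivR σ) q := (hdσ.differentiable (by simp)) q
    have heq : (fun q' : ℝ × ℝ => -(q'.1)⁻¹ * derivR σ q') = fun q' => -(q'.1⁻¹ * derivR σ q') := by
      funext q'; ring
    rw [heq, fderiv_fun_neg, norm_neg, fderiv_fun_mul hι hD]
    have h1 : ‖q.1⁻¹ • fderiv ℝ (derivR σ) q‖ ≤ S₂ / r₀ := by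
      rw [norm_smul, norm_inv, Real.norm_eq_abs, abs_of_pos (hr₀.trans_le hq), div_eq_inv_mul]
      exact mul_le_mul (inv_anti₀ hr₀ hq) ((norm_fderiv_derivR_le (hσ.of_le (by decide)) q).trans
        (hS₂ q)) (norm_nonneg _) (by positivity)
    have h2 : ‖(derivR σ q) • fderiv ℝ (fun q' : ℝ × ℝ => q'.1⁻¹) q‖ ≤ S₁ / r₀ ^ 2 := by
      rw [norm_smul, Real.norm_eq_abs, div_eq_mul_inv]
      exact mul_le_mul ((abs_derivR_le σ q).trans (hS₁ q)) (norm_fderiv_inv_fst_le hr₀ hq)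
        (norm_nonneg _) hS₁0
    calc ‖q.1⁻¹ • fderiv ℝ (derivR σ) q + (derivR σ q) • fderiv ℝ (fun q' : ℝ × ℝ => q'.1⁻¹) q‖
        ≤ ‖q.1⁻¹ • fderiv ℝ (derivR σ) q‖ + ‖(derivR σ q) • fderiv ℝ (fun q' : ℝ × ℝ => q'.1⁻¹) q‖ :=
          norm_add_le _ _
      _ ≤ S₂ / r₀ + S₁ / r₀ ^ 2 := add_le_add h1 h2

/-! ### The derivative of the source difference on `ℝ³` -/

/-- The meridian derivative map `h ↦ (⟪ρ̂, h⟫, h₂)` has operator norm `≤ 1` off the axis (sup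
norm on `ℝ × ℝ`). [folklore] -/
theorem norm_meridianDeriv_le {y : EuclideanSpace ℝ (Fin 3)} (hy : cylRadius y ≠ 0) :
    ‖(innerSL ℝ (eR y)).prod (EuclideanSpace.proj (2 : Fin 3) : EuclideanSpace ℝ (Fin 3) →L[ℝ] ℝ)‖ ≤ 1 := by
  have hn : ‖eR y‖ = 1 := by
    rw [norm_eq_sqrt_real_inner (F := EuclideanSpace ℝ (Fin 3)), inner_eR_self hy, Real.sqrt_one]
  refine ContinuousLinearMap.opNorm_le_bound _ zero_le_one fun h => ?_
  rw [one_mul, Prod.norm_def]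
  simp only [ContinuousLinearMap.prod_apply, innerSL_apply_apply]
  refine max_le ?_ ?_
  · calc ‖⟪eR y, h⟫‖ ≤ ‖eR y‖ * ‖h‖ := norm_inner_le_norm _ _
      _ = ‖h‖ := by rw [hn, one_mul]
  · simpa using PiLp.norm_apply_le h 2

/-- **Bound on `∇(G[u[v,f]] - G[u[v,g]])`**: with `σ = f² - g²`, `‖Dσ‖ ≤ S₁`, `‖D²σ‖ ≤ S₂` on the
plane and `r₀` the axis margin of `U`, `‖D(G[u[v,f]] - G[u[v,g]])(y)‖ ≤ S₂/r₀ + S₁/r₀²` for every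
`y ∈ ℝ³`. [cite: Ozanski2017NSISingular, App. A.3, first lemma (held: Lemma 23), proof] -/
theorem norm_fderiv_pressureSource_swirlField_sub_le (hf : IsNSIStructure U v f φ)
    (hg : IsNSIStructure U v g ψ) {r₀ : ℝ} (hr₀ : 0 < r₀) (hr : ∀ q ∈ closure U, r₀ ≤ q.1)
    {S₁ S₂ : ℝ} (hS₁ : ∀ q, ‖fderiv ℝ (fun q' => f q' ^ 2 - g q' ^ 2) q‖ ≤ S₁)
    (hS₂ : ∀ q, ‖fderiv ℝ (fderiv ℝ fun q' => f q' ^ 2 - g q' ^ 2) q‖ ≤ S₂)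
    (y : EuclideanSpace ℝ (Fin 3)) :
    ‖fderiv ℝ (fun y => pressureSource (swirlField v f) y - pressureSource (swirlField v g) y) y‖ ≤
      S₂ / r₀ + S₁ / r₀ ^ 2 := by
  have hS₁0 : 0 ≤ S₁ := (norm_nonneg _).trans (hS₁ 0)
  have hS₂0 : 0 ≤ S₂ := (norm_nonneg _).trans (hS₂ 0)
  have hE := hf.contDiff_sourceFactor hg hr₀ hr
  rw [hf.pressureSource_swirlField_sub_eq_comp hg]
  by_cases hyr : cylRadius y < r₀
  · -- the lifted factor vanishes near `y`
    have hopen : IsOpen {y' : EuclideanSpace ℝ (Fin 3) | cylRadius y' < r₀} :=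
      isOpen_lt continuous_cylRadius continuous_const
    have hzero : ∀ q : ℝ × ℝ, q.1 < r₀ →
        -(q.1)⁻¹ * derivR (fun q' => f q' ^ 2 - g q' ^ 2) q = 0 := by
      intro q hq
      have hopen' : IsOpen {q' : ℝ × ℝ | q'.1 < r₀} := isOpen_lt continuous_fst continuous_const
      have hev : (fun q' => f q' ^ 2 - g q' ^ 2) =ᶠ[𝓝 q] fun _ => (0 : ℝ) := by
        filter_upwards [hopen'.mem_nhds hq] with q' hq'
        have : q' ∉ closure U := fun h' => (hr q' h').not_gt hq'
        simp [hf.f_eq_zero this, hg.f_eq_zero this]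
      rw [derivR, hev.fderiv_eq, fderiv_const_apply]
      simp
    have hev : (fun y' : EuclideanSpace ℝ (Fin 3) =>
        (fun q : ℝ × ℝ => -(q.1)⁻¹ * derivR (fun q' => f q' ^ 2 - g q' ^ 2) q) (meridian y')) =ᶠ[𝓝 y]
        fun _ => (0 : ℝ) := by
      filter_upwards [hopen.mem_nhds hyr] with y' hy'
      exact hzero (meridian y') hy'
    rw [hev.fderiv_eq, fderiv_const_apply]
    simp only [ContinuousLinearMap.opNorm_zero]
    positivity
  · have hy0 : cylRadius y ≠ 0 := fun h => hyr (h ▸ hr₀)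
    have hd := hasFDerivAt_comp_meridian hy0 ((hE.differentiable (by simp)) (meridian y))
    rw [hd.fderiv]
    calc _ ≤ ‖fderiv ℝ (fun q : ℝ × ℝ => -(q.1)⁻¹ * derivR (fun q' => f q' ^ 2 - g q' ^ 2) q)
          (meridian y)‖ * ‖(innerSL ℝ (eR y)).prod
            (EuclideanSpace.proj (2 : Fin 3) : EuclideanSpace ℝ (Fin 3) →L[ℝ] ℝ)‖ :=
          ContinuousLinearMap.opNorm_comp_le _ _
      _ ≤ (S₂ / r₀ + S₁ / r₀ ^ 2) * 1 :=
          mul_le_mul (hf.norm_fderiv_sourceFactor_le hg hr₀ hr hS₁ hS₂ _) (norm_meridianDeriv_le hy0)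
            (norm_nonneg _) (by positivity)
      _ = S₂ / r₀ + S₁ / r₀ ^ 2 := mul_one _

/-! ### Lemma 23, quantitative: the pressure gradients of `u[v,f]`, `u[v,g]` -/

/-- **Ożański's first continuity lemma (App. A.3; held: Lemma 23), quantitative form on `ℝ³`.**
For two structures `(v,f,φ)`, `(v,g,ψ)` on the same `U ⋐ P` (axis margin `r₀`, `R(Ū) ⊆ B̄(0,R)`)
and `σ = f² - g²` with `‖Dσ‖ ≤ S₁`, `‖D²σ‖ ≤ S₂` on the plane,
`‖∇p*[v,f](x) - ∇p*[v,g](x)‖ ≤ (1 + (4π)⁻¹|B̄(0,R)|)(S₂/r₀ + S₁/r₀²)` for every `x ∈ ℝ³` — a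
modulus independent of `v` ("we do not require any convergence of the `v_k`'s").
[cite: Ozanski2017NSISingular, App. A.3, first lemma (held: Lemma 23)] -/
theorem norm_fderiv_normalisedPressure_swirlField_sub_le (hf : IsNSIStructure U v f φ)
    (hg : IsNSIStructure U v g ψ) {r₀ : ℝ} (hr₀ : 0 < r₀) (hr : ∀ q ∈ closure U, r₀ ≤ q.1)
    {R : ℝ} (hR : revolve (closure U) ⊆ closedBall (0 : EuclideanSpace ℝ (Fin 3)) R)
    {S₁ S₂ : ℝ} (hS₁ : ∀ q, ‖fderiv ℝ (fun q' => f q' ^ 2 - g q' ^ 2) q‖ ≤ S₁)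
    (hS₂ : ∀ q, ‖fderiv ℝ (fderiv ℝ fun q' => f q' ^ 2 - g q' ^ 2) q‖ ≤ S₂)
    (x : EuclideanSpace ℝ (Fin 3)) :
    ‖fderiv ℝ (normalisedPressure (swirlField v f)) x -
        fderiv ℝ (normalisedPressure (swirlField v g)) x‖ ≤
      (1 + (4 * π)⁻¹ * volume.real (closedBall (0 : EuclideanSpace ℝ (Fin 3)) R)) *
        (S₂ / r₀ + S₁ / r₀ ^ 2) :=
  norm_fderiv_normalisedPressure_sub_le_of_subset hf.contDiff_swirlField
    hf.hasCompactSupport_swirlField hg.contDiff_swirlField hg.hasCompactSupport_swirlField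
    (hf.tsupport_swirlField_subset.trans hR) (hg.tsupport_swirlField_subset.trans hR)
    (hf.norm_fderiv_pressureSource_swirlField_sub_le hg hr₀ hr hS₁ hS₂) x

/-- **Lemma 23 on the meridian plane, radial component**: under the same hypotheses,
`|∂ᵣp[v,f](q) - ∂ᵣp[v,g](q)| ≤ (1 + (4π)⁻¹|B̄(0,R)|)(S₂/r₀ + S₁/r₀²)` for every `q ∈ ℝ²`
("the claim of the lemma follows by setting `x₃ = 0`").
[cite: Ozanski2017NSISingular, App. A.3, first lemma (held: Lemma 23)] -/
theorem abs_derivR_planePressure_sub_le (hf : IsNSIStructure U v f φ)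
    (hg : IsNSIStructure U v g ψ) {r₀ : ℝ} (hr₀ : 0 < r₀) (hr : ∀ q ∈ closure U, r₀ ≤ q.1)
    {R : ℝ} (hR : revolve (closure U) ⊆ closedBall (0 : EuclideanSpace ℝ (Fin 3)) R)
    {S₁ S₂ : ℝ} (hS₁ : ∀ q, ‖fderiv ℝ (fun q' => f q' ^ 2 - g q' ^ 2) q‖ ≤ S₁)
    (hS₂ : ∀ q, ‖fderiv ℝ (fderiv ℝ fun q' => f q' ^ 2 - g q' ^ 2) q‖ ≤ S₂) (q : ℝ × ℝ) :
    |derivR (planePressure v f) q - derivR (planePressure v g) q| ≤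
      (1 + (4 * π)⁻¹ * volume.real (closedBall (0 : EuclideanSpace ℝ (Fin 3)) R)) *
        (S₂ / r₀ + S₁ / r₀ ^ 2) := by
  rw [hf.derivR_planePressure q, hg.derivR_planePressure q,
    show fderiv ℝ (normalisedPressure (swirlField v f)) (meridianPoint q)
        (EuclideanSpace.single (0 : Fin 3) (1 : ℝ)) -
      fderiv ℝ (normalisedPressure (swirlField v g)) (meridianPoint q)
        (EuclideanSpace.single (0 : Fin 3) (1 : ℝ)) =
      (fderiv ℝ (normalisedPressure (swirlField v f)) (meridianPoint q) -
        fderiv ℝ (normalisedPressure (swirlField v g)) (meridianPoint q))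
        (EuclideanSpace.single (0 : Fin 3) (1 : ℝ)) from rfl,
    ← Real.norm_eq_abs]
  refine (ContinuousLinearMap.le_opNorm _ _).trans ?_
  rw [norm_single_zero_eq_one, mul_one]
  exact hf.norm_fderiv_normalisedPressure_swirlField_sub_le hg hr₀ hr hR hS₁ hS₂ _

/-- **Lemma 23 on the meridian plane, axial component**:
`|∂_z p[v,f](q) - ∂_z p[v,g](q)| ≤ (1 + (4π)⁻¹|B̄(0,R)|)(S₂/r₀ + S₁/r₀²)`.
[cite: Ozanski2017NSISingular, App. A.3, first lemma (held: Lemma 23)] -/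
theorem abs_derivZ_planePressure_sub_le (hf : IsNSIStructure U v f φ)
    (hg : IsNSIStructure U v g ψ) {r₀ : ℝ} (hr₀ : 0 < r₀) (hr : ∀ q ∈ closure U, r₀ ≤ q.1)
    {R : ℝ} (hR : revolve (closure U) ⊆ closedBall (0 : EuclideanSpace ℝ (Fin 3)) R)
    {S₁ S₂ : ℝ} (hS₁ : ∀ q, ‖fderiv ℝ (fun q' => f q' ^ 2 - g q' ^ 2) q‖ ≤ S₁)
    (hS₂ : ∀ q, ‖fderiv ℝ (fderiv ℝ fun q' => f q' ^ 2 - g q' ^ 2) q‖ ≤ S₂) (q : ℝ × ℝ) :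
    |derivZ (planePressure v f) q - derivZ (planePressure v g) q| ≤
      (1 + (4 * π)⁻¹ * volume.real (closedBall (0 : EuclideanSpace ℝ (Fin 3)) R)) *
        (S₂ / r₀ + S₁ / r₀ ^ 2) := by
  rw [hf.derivZ_planePressure q, hg.derivZ_planePressure q,
    show fderiv ℝ (normalisedPressure (swirlField v f)) (meridianPoint q) eZ -
      fderiv ℝ (normalisedPressure (swirlField v g)) (meridianPoint q) eZ =
      (fderiv ℝ (normalisedPressure (swirlField v f)) (meridianPoint q) -
        fderiv ℝ (normalisedPressure (swirlField v g)) (meridianPoint q)) eZ from rfl,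
    ← Real.norm_eq_abs]
  refine (ContinuousLinearMap.le_opNorm _ _).trans ?_
  rw [norm_eZ_eq_one, mul_one]
  exact hf.norm_fderiv_normalisedPressure_swirlField_sub_le hg hr₀ hr hR hS₁ hS₂ _

end IsNSIStructure

/-- **Lemma 23 packaged with a constant depending only on `U`.** For every planar set `U` there
is `K ≥ 0` such that for all structures `(v,f,φ)`, `(v,g,ψ)` on `U` with the same `v` and all
bounds `‖D(f² - g²)‖ ≤ S₁`, `‖D²(f² - g²)‖ ≤ S₂` on the plane,
`|∇p[v,f](q) - ∇p[v,g](q)| ≤ K (S₁ + S₂)` componentwise for every `q` — in particular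
`∇p[v_k,f_k] - ∇p[v_k,f] → 0` uniformly whenever `f_k² - f² → 0` with two derivatives,
whatever the `v_k` (Ożański: "we do not require any convergence of the `v_k`'s"), and uniformly
in an extra parameter (time, the direction factor `a(t)v`), as used in (4.27).
[cite: Ozanski2017NSISingular, App. A.3, first lemma (held: Lemma 23)] -/
theorem exists_planePressure_sub_le (U : Set (ℝ × ℝ)) :
    ∃ K : ℝ, 0 ≤ K ∧ ∀ (v : ℝ × ℝ → ℝ × ℝ) (f g φ ψ : ℝ × ℝ → ℝ),
      IsNSIStructure U v f φ → IsNSIStructure U v g ψ → ∀ (S₁ S₂ : ℝ),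
      (∀ q, ‖fderiv ℝ (fun q' => f q' ^ 2 - g q' ^ 2) q‖ ≤ S₁) →
      (∀ q, ‖fderiv ℝ (fderiv ℝ fun q' => f q' ^ 2 - g q' ^ 2) q‖ ≤ S₂) → ∀ q : ℝ × ℝ,
        |derivR (planePressure v f) q - derivR (planePressure v g) q| ≤ K * (S₁ + S₂) ∧
        |derivZ (planePressure v f) q - derivZ (planePressure v g) q| ≤ K * (S₁ + S₂) := by
  by_cases hU : ∃ (v₀ : ℝ × ℝ → ℝ × ℝ) (f₀ φ₀ : ℝ × ℝ → ℝ), IsNSIStructure U v₀ f₀ φ₀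
  · obtain ⟨v₀, f₀, φ₀, h₀⟩ := hU
    obtain ⟨r₀, hr₀, hr⟩ := h₀.exists_axis_margin
    obtain ⟨R, hR⟩ := (isCompact_revolve h₀.isCompact_closure).isBounded.subset_closedBall
      (0 : EuclideanSpace ℝ (Fin 3))
    set V := volume.real (closedBall (0 : EuclideanSpace ℝ (Fin 3)) R) with hV
    have hV0 : 0 ≤ V := measureReal_nonneg
    refine ⟨(1 + (4 * π)⁻¹ * V) * (r₀⁻¹ + (r₀ ^ 2)⁻¹), by positivity,
      fun v f g φ ψ hf hg S₁ S₂ hS₁ hS₂ q => ?_⟩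
    have hS₁0 : 0 ≤ S₁ := (norm_nonneg _).trans (hS₁ 0)
    have hS₂0 : 0 ≤ S₂ := (norm_nonneg _).trans (hS₂ 0)
    have hmono : (1 + (4 * π)⁻¹ * V) * (S₂ / r₀ + S₁ / r₀ ^ 2) ≤
        (1 + (4 * π)⁻¹ * V) * (r₀⁻¹ + (r₀ ^ 2)⁻¹) * (S₁ + S₂) := by
      rw [mul_assoc]
      refine mul_le_mul_of_nonneg_left ?_ (by positivity)
      rw [div_eq_mul_inv, div_eq_mul_inv]
      nlinarith [mul_nonneg hS₁0 (inv_nonneg.2 hr₀.le), mul_nonneg hS₂0 (inv_nonneg.2 (sq_nonneg r₀)),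
        inv_nonneg.2 hr₀.le, inv_nonneg.2 (sq_nonneg r₀)]
    exact ⟨(hf.abs_derivR_planePressure_sub_le hg hr₀ hr hR hS₁ hS₂ q).trans hmono,
      (hf.abs_derivZ_planePressure_sub_le hg hr₀ hr hR hS₁ hS₂ q).trans hmono⟩
  · refine ⟨0, le_rfl, fun v f g φ ψ hf _ _ _ _ _ _ => ?_⟩
    exact absurd ⟨v, f, φ, hf⟩ hU

/-! ### Time-dependent profiles: joint smoothness of `(t,q) ↦ p[a(t)v, Q(t)](q)` -/

section Param

variable {S : Set ℝ} {a : ℝ → ℝ} {Q : ℝ → ℝ × ℝ → ℝ}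

/-- **The planar pressure of a smooth time-dependent family is jointly smooth**: for `S` open,
a direction `a ∈ C^∞(ℝ;[-1,1])`, a planar field `v ∈ C_c^∞(U)` (`Ū ⊆ P` compact) and profiles
`Q` jointly `C^∞` on `S × ℝ²`, nonnegative, vanishing off `Ū`, with `Q(t) > |v|` on `U`, the map
`(t,q) ↦ p[a(t)v, Q(t)](q)` is `C^∞` on `S × ℝ²` — the regularity behind the definition (4.16) of
`qᵏᵢ,ₜ` through `∫₀ᵗ aᵢᵏ(s) vᵢ·∇p[aⱼᵏ(s)vⱼ, hⱼ,ₛ] ds` and behind "all terms on the right-hand side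
of (4.16) are smooth (recall (3.21) for the smoothness of the pressure)" (§4.1).
[cite: Ozanski2017NSISingular, §4.1 (4.16) and (3.21)] -/
theorem contDiffOn_planePressure_param (hS : IsOpen S) (hUc : IsCompact (closure U))
    (hUP : closure U ⊆ halfPlane) (hv : ContDiff ℝ ∞ v) (hvU : tsupport v ⊆ U)
    (ha : ContDiff ℝ ∞ a) (ha1 : ∀ t, |a t| ≤ 1)
    (hQ : ContDiffOn ℝ ∞ (uncurry Q) (S ×ˢ univ)) (hQ0 : ∀ t ∈ S, ∀ q, 0 ≤ Q t q)
    (hQz : ∀ t ∈ S, ∀ q ∉ closure U, Q t q = 0)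
    (hQv : ∀ t ∈ S, ∀ q ∈ U, (v q).1 ^ 2 + (v q).2 ^ 2 < Q t q ^ 2) :
    ContDiffOn ℝ ∞ (uncurry fun t q => planePressure (a t • v) (Q t) q) (S ×ˢ univ) := by
  have hu := isSmoothSpaceTimeOn_swirlField_param (S := S) hUc hUP hv hvU ha ha1 hQ hQ0 hQz hQv
  -- all slices vanish off the compact solid of revolution `R(Ū)`
  have h0 : ∀ t ∈ S, ∀ x ∉ revolve (closure U), swirlField (a t • v) (Q t) x = 0 := by
    intro t ht x hx
    have hx' : meridian x ∉ closure U := fun h => hx (mem_revolve.2 h)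
    have hvx : v (meridian x) = 0 :=
      image_eq_zero_of_notMem_tsupport fun h => hx' (subset_closure (hvU h))
    simp only [swirlField, hQz t ht _ hx', Pi.smul_apply, hvx, smul_zero]
    simp
  have hp : ContDiffOn ℝ ∞
      (uncurry fun t x => normalisedPressure (swirlField (a t • v) (Q t)) x)
      (S ×ˢ (univ : Set (EuclideanSpace ℝ (Fin 3)))) :=
    isSmoothSpaceTimeOn_normalisedPressure hS hu (isCompact_revolve hUc) h0
  -- compose with the meridian embedding
  have hm : ContDiff ℝ ∞ fun p : ℝ × (ℝ × ℝ) => (p.1, meridianPoint p.2) :=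
    contDiff_fst.prodMk (contDiff_meridianPoint.comp contDiff_snd)
  have hmaps : MapsTo (fun p : ℝ × (ℝ × ℝ) => (p.1, meridianPoint p.2)) (S ×ˢ univ)
      (S ×ˢ (univ : Set (EuclideanSpace ℝ (Fin 3)))) := fun p hp' => ⟨hp'.1, mem_univ _⟩
  have hcomp := hp.comp hm.contDiffOn hmaps
  refine hcomp.congr ?_
  rintro ⟨t, q⟩ -
  rfl

end Param

end Literature.Barriers.NavierStokesRegularity

end
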